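import Summits.ValiantsHypothesis.ValiantsHypothesis.Theorems.BarrierLeverAnchoredDoorHitsLowerPairsCrossed

/-!
# Support item `AnchoredDoorHitsLowerPairs` (stmt-ValiantsHypothesis-22510), line `anchored-peeling`:
# RE-ENUMERATION INVARIANCE of the layout minors

Helper file (`--supports stmt-ValiantsHypothesis-22510`; cell valiant-natproofs, rung V4, 𝒟-side door (c); registered line
`Cruxes/AnchoredDoorHitsLowerPairs/Lines/anchored_peeling.lean` v10; prover seat val-np-p1 gen 18). Definition-free. Closes NO item.

The reduction theorems of the line (`stub_starStep`, `DTPeel.symbolicDet_ne_zero_of_dtsStep`, `DTPeel.genDet_ne_zero_of_split`, …) ask for the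
non-vanishing of the symbolic minor of EVERY injective enumeration of a sub-pair with prescribed row and column RANGES, while a certificate
(a routing, a decomposing stage, the permutation member, a `decide` computation) delivers it for ONE enumeration. This file closes the gap once
and for all: a layout minor built from any kernel `K U T` depends on the enumerations only up to sign.

* `det_kernel_ne_zero_of_range_eq` — for any `K : Finset (Fin h) → Finset (Fin h) → A` (commutative ring `A`), injective `u, w, u', w'` with
  `Set.range u' = Set.range u`, `Set.range w' = Set.range w`: `det (K (u i) (w j)) ≠ 0 → det (K (u' i) (w' j)) ≠ 0`.
* `symbolicDet_ne_zero_of_range_eq`, `crossedDet_ne_zero_of_range_eq` — the instances for the symbolic door and the crossed member.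

WHAT THIS IS NOT: nothing on items 22510 / 19717 themselves, on crux stmt-ValiantsHypothesis-14610 or on `VP` versus `VNP`.
-/

set_option linter.dupNamespace false

namespace Summit.ValiantsHypothesis.ValiantsHypothesis.Theorems.BarrierLever.AnchoredPeeling

open Finset MvPolynomial
open Summit.ValiantsHypothesis.ValiantsHypothesis.Theorems.BarrierLever.BrickCalculus (pexpo pexpo_def)

noncomputable section

variable {h : ℕ}

/-- Two injective enumerations with the same range differ by a bijection of the index types. -/
theorem exists_equiv_of_range_eq {r r' : ℕ} {β : Type*} (u : Fin r → β) (u' : Fin r' → β)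
    (hu : Function.Injective u) (hu' : Function.Injective u') (hru : Set.range u' = Set.range u) :
    ∃ e : Fin r' ≃ Fin r, ∀ i, u (e i) = u' i := by
  classical
  have hex : ∀ i, ∃ k, u k = u' i := fun i => by
    have hi : u' i ∈ Set.range u := hru ▸ ⟨i, rfl⟩
    obtain ⟨k, hk⟩ := hi
    exact ⟨k, hk⟩
  choose f hf using hex
  have hinj : Function.Injective f := fun i i' hii => hu' (by rw [← hf i, ← hf i', hii])
  have hsurj : Function.Surjective f := by
    intro k
    have hk : u k ∈ Set.range u' := hru.symm ▸ ⟨k, rfl⟩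
    obtain ⟨i, hi⟩ := hk
    exact ⟨i, hu (by rw [hf i, hi])⟩
  exact ⟨Equiv.ofBijective f ⟨hinj, hsurj⟩, fun i => hf i⟩

/-- **Re-enumeration invariance.** A layout minor built from a kernel `K` is nonzero for one pair of injective enumerations iff for every pair with the
same ranges. -/
theorem det_kernel_ne_zero_of_range_eq {A : Type*} [CommRing A] {r r' : ℕ} (K : Finset (Fin h) → Finset (Fin h) → A)
    (u w : Fin r → Finset (Fin h)) (u' w' : Fin r' → Finset (Fin h))
    (hu : Function.Injective u) (hw : Function.Injective w) (hu' : Function.Injective u') (hw' : Function.Injective w')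
    (hru : Set.range u' = Set.range u) (hrw : Set.range w' = Set.range w)
    (hne : (Matrix.of fun i j : Fin r => K (u i) (w j)).det ≠ 0) :
    (Matrix.of fun i j : Fin r' => K (u' i) (w' j)).det ≠ 0 := by
  classical
  obtain ⟨e, he⟩ := exists_equiv_of_range_eq u u' hu hu' hru
  obtain ⟨e', he'⟩ := exists_equiv_of_range_eq w w' hw hw' hrw
  have hM : (Matrix.of fun i j : Fin r' => K (u' i) (w' j)) =
      ((Matrix.of fun i j : Fin r => K (u i) (w j)).submatrix e e).submatrix id (e'.trans e.symm) := by
    ext i j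
    simp only [Matrix.submatrix_apply, Matrix.of_apply, id, Equiv.trans_apply, Equiv.apply_symm_apply, he, he']
  rw [hM, Matrix.det_permute', Matrix.det_submatrix_equiv_self]
  intro h0
  rcases Int.units_eq_one_or (Equiv.Perm.sign (e'.trans e.symm)) with h1 | h1
  · rw [h1] at h0; simp at h0; exact hne h0
  · rw [h1] at h0; simp at h0; exact hne h0

/-- Re-enumeration invariance for the symbolic anchored minor. -/
theorem symbolicDet_ne_zero_of_range_eq {s r r' : ℕ} (u w : Fin r → Finset (Fin h)) (u' w' : Fin r' → Finset (Fin h))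
    (hu : Function.Injective u) (hw : Function.Injective w) (hu' : Function.Injective u') (hw' : Function.Injective w')
    (hru : Set.range u' = Set.range u) (hrw : Set.range w' = Set.range w) (hne : symbolicDet s h r u w ≠ 0) :
    symbolicDet s h r' u' w' ≠ 0 := by
  have key := det_kernel_ne_zero_of_range_eq (fun U T => coeff (pexpo U T) (symbolicWitness s h)) u w u' w' hu hw hu' hw' hru hrw
  simp only [pexpo_def] at key
  exact key hne

/-- Re-enumeration invariance for the crossed minor. -/
theorem crossedDet_ne_zero_of_range_eq {r r' : ℕ} (u w : Fin r → Finset (Fin h)) (u' w' : Fin r' → Finset (Fin h))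
    (hu : Function.Injective u) (hw : Function.Injective w) (hu' : Function.Injective u') (hw' : Function.Injective w')
    (hru : Set.range u' = Set.range u) (hrw : Set.range w' = Set.range w) (hne : crossedDet h r u w ≠ 0) :
    crossedDet h r' u' w' ≠ 0 :=
  det_kernel_ne_zero_of_range_eq (fun U T => coeff (pexpo U T) (crossedWitness h)) u w u' w' hu hw hu' hw' hru hrw hne

end

end Summit.ValiantsHypothesis.ValiantsHypothesis.Theorems.BarrierLever.AnchoredPeeling
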